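import Mathlib.Combinatorics.SimpleGraph.LineGraph
import Mathlib.Combinatorics.SimpleGraph.Coloring.Vertex
import Literature.Combinatorics.SimpleGraph.BrinkmannTuckerVanCleemput2021.G70
import Literature.Combinatorics.SimpleGraph.BrinkmannTuckerVanCleemput2021.KernelB
import Literature.Combinatorics.SimpleGraph.BrinkmannTuckerVanCleemput2021.KernelC
import HarnessLib

/-!
# `G70` has no 3-edge-colouring (it is of class 2)

G. Brinkmann, T. Tucker, N. Van Cleemput, DMTCS **23**:3 (2021) #4 [BrinkmannTuckerVancleemput2021],
§3.1: "It is neither known whether Kochol's graph is the smallest counterexample nor whether there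
are counterexamples with smaller genus."  This module supplies the colouring half of the negative
answer to the first question: the 70-vertex cubic graph `G70` of `…G70` (same directory) admits
no proper 3-edge-colouring — `no_three_edge_colouring` on edge ids, `not_colorable_three` for
Mathlib's line graph `G70.lineGraph` — so (Vizing) its chromatic index is 4; `…Embedding` supplies
the polyhedral genus-5 rotation system.

Proof = kernel evaluation + the completeness theorem `run_complete` of `…Search`.  With the data
of `…SearchData`: a proper colouring `c` restricted to block `B` passes every comparison of
`progB`, so the bit of `tabB` at the code of `c`'s four `A–B` cut colours is set (`tabB_spec`,
kernel); likewise for `C`; hence `c` restricted to the 37 edges met by block `A` passes every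
comparison of `progA` AND its leaf test `leafA` — contradicting `runA_false : run leafA progA [] =
false` (kernel, 10 936 nodes).  The decomposition along the two 4-edge cuts replaces one search of
several million nodes by three of `≤ 44 000`.

Provenance: refutations bundle `papers/_cross/refutations` (H21 seat pub-refute-2, 2026-08-18);
the programs and tables were GENERATED by that seat's `g16/gen_data.py` (pure Python; it also
re-runs the three searches) from the rotation table of `…BrinkmannTuckerVanCleemput2021.G70`;
written for the tree under the Lean-in-tree rule (human 2026-08-18).
-/

namespace Literature.Combinatorics.SimpleGraph.BrinkmannTuckerVanCleemput2021

open _root_.SimpleGraph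

/-- Kernel fact: the three programs are valid — every comparison they make is between two touching
edges (`valid` of `…Search`, conflict relation `touches`). [folklore] -/
theorem progs_valid :
    (valid touches progB [9, 15, 28, 33] && valid touches progC [2, 8, 10, 25] &&
      valid touches progA []) = true := by
  decide +kernel

/-- Kernel fact: block `A`'s search with the table leaf test finds nothing. [folklore] -/
theorem runA_false : run leafA progA [] = false := by
  decide +kernel

/-- Kernel fact: where the eight cut edges sit in block `A`'s final stack (length 37).
[folklore] -/
theorem finalA_facts :
    (final progA []).length = 37 ∧
      (final progA []).getD 1 0 = 9 ∧
      (final progA []).getD 3 0 = 15 ∧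
      (final progA []).getD 10 0 = 28 ∧
      (final progA []).getD 17 0 = 33 ∧
      (final progA []).getD 34 0 = 2 ∧
      (final progA []).getD 2 0 = 8 ∧
      (final progA []).getD 0 0 = 10 ∧
      (final progA []).getD 12 0 = 25 := by
  decide +kernel

/-- **No conflict-respecting 3-colouring of the edge ids.**  There is no `c : ℕ → ℕ` with values
`< 3` giving different values to touching edges of `G70`.
[cite: BrinkmannTuckerVancleemput2021, §3.1] -/
theorem no_touching_colouring (c : ℕ → ℕ) (hc : ∀ e, c e < 3)
    (hadj : ∀ e f, touches e f = true → c e ≠ c f) : False := by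
  have hv := progs_valid
  simp only [Bool.and_eq_true] at hv
  obtain ⟨⟨hvB, hvC⟩, hvA⟩ := hv
  obtain ⟨hlen, hp1, hp2, hp3, hp4, hq1, hq2, hq3, hq4⟩ := finalA_facts
  -- the two block searches accept the cut colourings of `c`
  have hB : run (fun _ => true) progB [c 9, c 15, c 28, c 33] = true :=
    run_complete hc hadj (fun _ => true) progB [9, 15, 28, 33] hvB rfl
  have hC : run (fun _ => true) progC [c 2, c 8, c 10, c 25] = true :=
    run_complete hc hadj (fun _ => true) progC [2, 8, 10, 25] hvC rfl
  -- hence the corresponding table bits are set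
  have kB : (Nat.testBit tabB (c 9 + 3 * (c 15 + 3 * (c 28 + 3 * c 33))) ==
      run (fun _ => true) progB (dec (c 9 + 3 * (c 15 + 3 * (c 28 + 3 * c 33))))) = true :=
    List.all_eq_true.1 tabB_spec _ (List.mem_range.2 (code_lt _ _ _ _ (hc _) (hc _) (hc _) (hc _)))
  rw [dec_code _ _ _ _ (hc _) (hc _) (hc _) (hc _), hB] at kB
  have kC : (Nat.testBit tabC (c 2 + 3 * (c 8 + 3 * (c 10 + 3 * c 25))) ==
      run (fun _ => true) progC (dec (c 2 + 3 * (c 8 + 3 * (c 10 + 3 * c 25))))) = true :=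
    List.all_eq_true.1 tabC_spec _ (List.mem_range.2 (code_lt _ _ _ _ (hc _) (hc _) (hc _) (hc _)))
  rw [dec_code _ _ _ _ (hc _) (hc _) (hc _) (hc _), hC] at kC
  -- so the leaf test accepts the final stack of block `A` under `c`
  have hleaf : leafA ((final progA []).map c) = true := by
    have eB : code ((final progA []).map c) posB =
        c 9 + 3 * (c 15 + 3 * (c 28 + 3 * c 33)) := by
      rw [code_map c _ posB (by rw [hlen]; decide) (by rw [hlen]; decide) (by rw [hlen]; decide)
        (by rw [hlen]; decide)]
      simp only [posB]
      rw [hp1, hp2, hp3, hp4]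
    have eC : code ((final progA []).map c) posC =
        c 2 + 3 * (c 8 + 3 * (c 10 + 3 * c 25)) := by
      rw [code_map c _ posC (by rw [hlen]; decide) (by rw [hlen]; decide) (by rw [hlen]; decide)
        (by rw [hlen]; decide)]
      simp only [posC]
      rw [hq1, hq2, hq3, hq4]
    rw [leafA, eB, eC, Bool.and_eq_true]
    exact ⟨by simpa using kB, by simpa using kC⟩
  -- and block `A`'s search would succeed: contradiction with the kernel evaluation
  have hA : run leafA progA [] = true := run_complete hc hadj leafA progA [] hvA hleaf
  rw [runA_false] at hA
  exact Bool.false_ne_true hA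

/-- **`G70` has no proper 3-edge-colouring** (edge ids `Fin 105`, "proper" = touching edges get
different colours). [cite: BrinkmannTuckerVancleemput2021, §3.1] -/
theorem no_three_edge_colouring :
    ¬ ∃ c : Fin 105 → Fin 3, ∀ e f : Fin 105, touches e f = true → c e ≠ c f := by
  rintro ⟨c, hc⟩
  refine no_touching_colouring (fun e => if h : e < 105 then (c ⟨e, h⟩ : ℕ) else 0)
    (fun e => ?_) (fun e f ht => ?_)
  · split
    · exact (c _).isLt
    · decide
  · have ht' := ht
    simp only [touches, Bool.and_eq_true, decide_eq_true_eq] at ht'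
    obtain ⟨⟨⟨he, hf⟩, -⟩, -⟩ := ht'
    rw [dif_pos he, dif_pos hf]
    exact fun h => hc ⟨e, he⟩ ⟨f, hf⟩ ht (Fin.ext h)

/-! ### The same in Mathlib's vocabulary: the line graph of `G70` is not 3-colourable -/

/-- Edge id `e` as an unordered pair of vertices of `G70`. [folklore] -/
def edgeSym (e : Fin 105) : Sym2 (Fin 70) :=
  s(⟨(endpts e).1 % 70, Nat.mod_lt _ (by decide)⟩, ⟨(endpts e).2 % 70, Nat.mod_lt _ (by decide)⟩)

/-- The shared endpoint of two touching edge ids (junk otherwise). [folklore] -/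
def sharedVx (e f : Fin 105) : Fin 70 :=
  if Nat.beq (endpts e).1 (endpts f).1 || Nat.beq (endpts e).1 (endpts f).2 then
    ⟨(endpts e).1 % 70, Nat.mod_lt _ (by decide)⟩
  else ⟨(endpts e).2 % 70, Nat.mod_lt _ (by decide)⟩

/-- Every listed edge is an edge of `G70`. [folklore] -/
theorem edgeSym_mem : ∀ e : Fin 105, edgeSym e ∈ G70.edgeSet := by
  decide +kernel

/-- Touching edge ids are different unordered pairs. [folklore] -/
theorem edgeSym_ne : ∀ e f : Fin 105, touches e f = true → edgeSym e ≠ edgeSym f := by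
  decide +kernel

/-- Touching edge ids share the vertex `sharedVx e f`. [folklore] -/
theorem sharedVx_mem :
    ∀ e f : Fin 105, touches e f = true → sharedVx e f ∈ edgeSym e ∧ sharedVx e f ∈ edgeSym f := by
  decide +kernel

/-- Touching edge ids are adjacent vertices of the line graph `G70.lineGraph`. [folklore] -/
theorem lineGraph_adj_of_touches (e f : Fin 105) (h : touches e f = true) :
    G70.lineGraph.Adj ⟨edgeSym e, edgeSym_mem e⟩ ⟨edgeSym f, edgeSym_mem f⟩ := by
  rw [lineGraph_adj_iff_exists]
  exact ⟨fun heq => edgeSym_ne e f h (congrArg Subtype.val heq), sharedVx e f,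
    (sharedVx_mem e f h).1, (sharedVx_mem e f h).2⟩

/-- **The line graph of `G70` is not 3-colourable**: `G70` is a cubic graph of class 2, i.e. of
chromatic index 4. [cite: BrinkmannTuckerVancleemput2021, §3.1] -/
theorem not_colorable_three : ¬ G70.lineGraph.Colorable 3 := fun ⟨C⟩ =>
  no_three_edge_colouring ⟨fun e => C ⟨edgeSym e, edgeSym_mem e⟩,
    fun e f h => C.valid (lineGraph_adj_of_touches e f h)⟩

end Literature.Combinatorics.SimpleGraph.BrinkmannTuckerVanCleemput2021
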